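import Summits.ValiantsHypothesis.ValiantsHypothesis.Theorems.BarrierLeverDefinableEquationsUnipotentTranslates

/-!
# Cruxes `BarrierLever.DefinableEquations` (8745) / `SingleSizeEquations` (8749) — the UNIPOTENT
# ACTION on coefficient vectors: group law and the coefficient action `T_s`

Second file of the "U-half" of the normal-form programme (design memo `HWV-NORMAL-FORM-PLAN.md`,
evidence #9 on stmt-ValiantsHypothesis-8749).  In the coordinates `s = (s_ij)_{i<j}` (matrix
entries) of the upper unitriangular group `U_n`, the substitution `u_s : x_j ↦ x_j + Σ_{i<j} s_ij x_i`
(`unip s`, the literal expression of `…UnipotentTranslates.lean`) satisfies the GROUP LAW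
`(f ∘ u_t) ∘ u_s = f ∘ u_{s ⋆ t}` with `(s ⋆ t)_kj = s_kj + t_kj + Σ_{k<i<j} s_ki t_ij` (`ulaw`,
`aeval_unip_unip`, `aeval_unip_aeval_unip`) — jointly homogeneous of "root height" `j - k`, which
is what makes the top-height extraction of `…UnipotentInvariants.lean` `U`-invariant.  On coefficient
vectors `c ∈ ℂ^N` (`N = C(2n,n)` monomials of degree `≤ n`) the action is
`T_s c := coeff (f_c ∘ u_s)` with `f_c = Σ_m c_m x^m` (`ofCoeffs`, `uAct`); it is linear in `c`
(`uAct_eq_sum`), `T_0 = id`, and `T_s (T_t c) = T_{s ⋆ t} c` (`uAct_uAct`).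

Elementary; two small definitions (`unip`, `ulaw`, `ofCoeffs`, `uAct` are abbreviations of explicit
expressions), no named facts.  HONEST FRAMING: infrastructure for a normal form; nothing here bears
on the open content of the cruxes.  References: [Burgisser2000] Rem. 2.7; [MignonRessayre2004] §1.
-/

-- layout Summits/ValiantsHypothesis/ValiantsHypothesis forces the duplicated namespace component
set_option linter.dupNamespace false

noncomputable section

open MvPolynomial

namespace Summit.ValiantsHypothesis.ValiantsHypothesis.Theorems.BarrierLever.IsobaricEquations

open Literature.Computability.AlgebraicComplexity Literature.Barriers.ValiantsHypothesis

variable {n : ℕ}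

/-! ## §1 The unitriangular substitution and its group law -/

/-- The upper unitriangular substitution `u_s : x_j ↦ x_j + Σ_{i<j} s_ij x_i` (the literal
expression used in `…UnipotentTranslates.lean`). [cite: Burgisser2000, Rem. 2.7] -/
def unip (s : Fin n → Fin n → ℂ) (j : Fin n) : MvPolynomial (Fin n) ℂ :=
  X j + ∑ i ∈ Finset.univ.filter (fun i : Fin n => i < j), C (s i j) * X i

/-- The group law of `U_n` in the matrix-entry coordinates:
`(s ⋆ t)_kj = s_kj + t_kj + Σ_{k<i<j} s_ki t_ij`. [folklore] -/
def ulaw (s t : Fin n → Fin n → ℂ) (k j : Fin n) : ℂ :=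
  s k j + t k j + ∑ i ∈ Finset.univ.filter (fun i : Fin n => k < i ∧ i < j), s k i * t i j

/-- Unfolding `unip`. [folklore] -/
theorem unip_apply (s : Fin n → Fin n → ℂ) (j : Fin n) :
    unip s j = X j + ∑ i ∈ Finset.univ.filter (fun i : Fin n => i < j), C (s i j) * X i := rfl

/-- `u_0 = id`. [folklore] -/
theorem unip_zero : unip (n := n) (fun _ _ => 0) = X := by
  funext j
  rw [unip_apply]
  simp

/-- **Group law on generators**: `u_s(u_t(x_j)) = u_{s ⋆ t}(x_j)`. [folklore] -/
theorem aeval_unip_unip (s t : Fin n → Fin n → ℂ) (j : Fin n) :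
    aeval (unip s) (unip t j) = unip (ulaw s t) j := by
  classical
  -- the double sum `Σ_{i<j} t_ij Σ_{k<i} s_ki x_k = Σ_{k<j} (Σ_{k<i<j} s_ki t_ij) x_k`
  have hswap : ∑ i ∈ Finset.univ.filter (fun i : Fin n => i < j),
      ∑ k ∈ Finset.univ.filter (fun k : Fin n => k < i), C (t i j) * (C (s k i) * X k) =
      ∑ k ∈ Finset.univ.filter (fun k : Fin n => k < j),
        ∑ i ∈ Finset.univ.filter (fun i : Fin n => k < i ∧ i < j),
          C (t i j) * (C (s k i) * X k) := by
    refine Finset.sum_comm' fun i k => ?_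
    simp only [Finset.mem_filter, Finset.mem_univ, true_and]
    constructor
    · rintro ⟨hij, hki⟩; exact ⟨⟨hki, hij⟩, lt_trans hki hij⟩
    · rintro ⟨⟨hki, hij⟩, _⟩; exact ⟨hij, hki⟩
  have hL : aeval (unip s) (unip t j) = X j +
      ((∑ k ∈ Finset.univ.filter (fun k : Fin n => k < j), C (s k j) * X k) +
       ((∑ k ∈ Finset.univ.filter (fun k : Fin n => k < j), C (t k j) * X k) +
        ∑ i ∈ Finset.univ.filter (fun i : Fin n => i < j),
          ∑ k ∈ Finset.univ.filter (fun k : Fin n => k < i), C (t i j) * (C (s k i) * X k))) := by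
    rw [unip_apply, map_add, aeval_X, map_sum, unip_apply, add_assoc]
    congr 2
    rw [← Finset.sum_add_distrib]
    refine Finset.sum_congr rfl fun i _ => ?_
    rw [map_mul, aeval_C, algebraMap_eq, aeval_X, unip_apply, mul_add, Finset.mul_sum]
  have hR : unip (ulaw s t) j = X j +
      ((∑ k ∈ Finset.univ.filter (fun k : Fin n => k < j), C (s k j) * X k) +
       ((∑ k ∈ Finset.univ.filter (fun k : Fin n => k < j), C (t k j) * X k) +
        ∑ k ∈ Finset.univ.filter (fun k : Fin n => k < j),
          ∑ i ∈ Finset.univ.filter (fun i : Fin n => k < i ∧ i < j),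
            C (t i j) * (C (s k i) * X k))) := by
    rw [unip_apply, ← Finset.sum_add_distrib, ← Finset.sum_add_distrib]
    congr 1
    refine Finset.sum_congr rfl fun k _ => ?_
    have hi : ∑ i ∈ Finset.univ.filter (fun i : Fin n => k < i ∧ i < j), C (t i j) * (C (s k i) * X k) =
        ∑ i ∈ Finset.univ.filter (fun i : Fin n => k < i ∧ i < j),
          (C (s k i * t i j) * X k : MvPolynomial (Fin n) ℂ) :=
      Finset.sum_congr rfl fun i _ => by rw [map_mul]; ring
    rw [hi, ulaw, map_add, map_add, map_sum, add_mul, add_mul, Finset.sum_mul, add_assoc]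
  rw [hL, hR, hswap]

/-- **Group law**: `(f ∘ u_t) ∘ u_s = f ∘ u_{s ⋆ t}`, i.e.
`aeval (unip s) (aeval (unip t) f) = aeval (unip (s ⋆ t)) f`. [folklore] -/
theorem aeval_unip_aeval_unip (s t : Fin n → Fin n → ℂ) (f : MvPolynomial (Fin n) ℂ) :
    aeval (unip s) (aeval (unip t) f) = aeval (unip (ulaw s t)) f := by
  induction f using MvPolynomial.induction_on with
  | C a => simp only [aeval_C, algebraMap_eq]
  | add p q hp hq => simp only [map_add, hp, hq]
  | mul_X p j hp => simp only [map_mul, hp, aeval_X, aeval_unip_unip]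

/-- `u_s` does not raise the degree. [cite: Burgisser2000, §2.1] -/
theorem totalDegree_aeval_unip_le (s : Fin n → Fin n → ℂ) (f : MvPolynomial (Fin n) ℂ) :
    (aeval (unip s) f).totalDegree ≤ f.totalDegree :=
  totalDegree_aeval_affine_le _ (unipotent_affine s) f

/-! ## §2 Coefficient vectors and the coefficient action `T_s` -/

section coeffs

variable [Fintype (degLEMonomials n)]

/-- The polynomial with coefficient vector `c` on the monomials of degree `≤ n`:
`f_c = Σ_m c_m x^m`. [cite: ForbesShpilkaVolk2018, Def. 1] -/
def ofCoeffs (c : degLEMonomials n → ℂ) : MvPolynomial (Fin n) ℂ :=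
  ∑ m : degLEMonomials n, monomial (m : Fin n →₀ ℕ) (c m)

/-- `coeff_m f_c = c_m` for `|m| ≤ n`. [folklore] -/
theorem coeff_ofCoeffs (c : degLEMonomials n → ℂ) (m : degLEMonomials n) :
    coeff (m : Fin n →₀ ℕ) (ofCoeffs c) = c m := by
  classical
  unfold ofCoeffs
  rw [coeff_sum, Finset.sum_eq_single m]
  · rw [coeff_monomial, if_pos rfl]
  · intro m' _ hm'
    rw [coeff_monomial, if_neg]
    exact fun h => hm' (Subtype.ext h)
  · intro h; exact absurd (Finset.mem_univ m) h

/-- `coeff_m f_c = 0` for `|m| > n`. [folklore] -/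
theorem coeff_ofCoeffs_eq_zero (c : degLEMonomials n → ℂ) (m : Fin n →₀ ℕ)
    (hm : m ∉ degLEMonomials n) : coeff m (ofCoeffs c) = 0 := by
  classical
  unfold ofCoeffs
  rw [coeff_sum]
  refine Finset.sum_eq_zero fun m' _ => ?_
  rw [coeff_monomial, if_neg]
  rintro rfl; exact hm m'.2

/-- `deg f_c ≤ n`. [folklore] -/
theorem totalDegree_ofCoeffs_le (c : degLEMonomials n → ℂ) : (ofCoeffs c).totalDegree ≤ n := by
  unfold ofCoeffs
  refine totalDegree_finsetSum_le fun m _ => (totalDegree_monomial_le _ _).trans ?_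
  have h := m.2
  simp only [degLEMonomials, Set.mem_setOf_eq, Finsupp.degree_apply] at h
  exact h

/-- `coeff (f_c) = c`. [folklore] -/
theorem coeffVector_ofCoeffs (c : degLEMonomials n → ℂ) :
    coeffVector (degLEMonomials n) (ofCoeffs c) = c := by
  funext m; rw [coeffVector_apply, coeff_ofCoeffs]

/-- `f_{coeff f} = f` for `deg f ≤ n`. [folklore] -/
theorem ofCoeffs_coeffVector (f : MvPolynomial (Fin n) ℂ) (hf : f.totalDegree ≤ n) :
    ofCoeffs (coeffVector (degLEMonomials n) f) = f := by
  classical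
  refine MvPolynomial.ext _ _ fun m => ?_
  by_cases hm : m ∈ degLEMonomials n
  · rw [show m = ((⟨m, hm⟩ : degLEMonomials n) : Fin n →₀ ℕ) from rfl, coeff_ofCoeffs,
      coeffVector_apply]
  · rw [coeff_ofCoeffs_eq_zero _ _ hm]
    symm
    rw [← notMem_support_iff]
    intro hms
    apply hm
    simp only [degLEMonomials, Set.mem_setOf_eq, Finsupp.degree_apply]
    exact (le_totalDegree hms).trans hf

/-- **The coefficient action** `T_s c := coeff (f_c ∘ u_s)` of the unipotent translate on
coefficient vectors. [cite: Burgisser2000, Rem. 2.7] -/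
def uAct (s : Fin n → Fin n → ℂ) (c : degLEMonomials n → ℂ) : degLEMonomials n → ℂ :=
  coeffVector (degLEMonomials n) (aeval (unip s) (ofCoeffs c))

/-- Unfolding `uAct`. [folklore] -/
theorem uAct_apply (s : Fin n → Fin n → ℂ) (c : degLEMonomials n → ℂ) (m : degLEMonomials n) :
    uAct s c m = coeff (m : Fin n →₀ ℕ) (aeval (unip s) (ofCoeffs c)) := rfl

/-- `f_{T_s c} = f_c ∘ u_s`. [folklore] -/
theorem ofCoeffs_uAct (s : Fin n → Fin n → ℂ) (c : degLEMonomials n → ℂ) :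
    ofCoeffs (uAct s c) = aeval (unip s) (ofCoeffs c) :=
  ofCoeffs_coeffVector _ ((totalDegree_aeval_unip_le s _).trans (totalDegree_ofCoeffs_le c))

/-- `T_0 = id`. [folklore] -/
theorem uAct_zero (c : degLEMonomials n → ℂ) : uAct (fun _ _ => 0) c = c := by
  unfold uAct
  rw [unip_zero, aeval_X_left, AlgHom.coe_id, id_eq, coeffVector_ofCoeffs]

/-- **`T` is an action**: `T_s (T_t c) = T_{s ⋆ t} c`. [folklore] -/
theorem uAct_uAct (s t : Fin n → Fin n → ℂ) (c : degLEMonomials n → ℂ) :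
    uAct s (uAct t c) = uAct (ulaw s t) c := by
  unfold uAct
  rw [show ofCoeffs (coeffVector (degLEMonomials n) (aeval (unip t) (ofCoeffs c))) =
      aeval (unip t) (ofCoeffs c) from ofCoeffs_uAct t c, aeval_unip_aeval_unip]

/-- The coefficient action on the coefficient vector of a polynomial of degree `≤ n`:
`T_s (coeff f) = coeff (f ∘ u_s)`. [folklore] -/
theorem uAct_coeffVector (s : Fin n → Fin n → ℂ) (f : MvPolynomial (Fin n) ℂ)
    (hf : f.totalDegree ≤ n) :
    uAct s (coeffVector (degLEMonomials n) f) = coeffVector (degLEMonomials n) (aeval (unip s) f) := by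
  unfold uAct
  rw [ofCoeffs_coeffVector f hf]

/-- The matrix of `T_s`: `A^s_{m m'} = coeff_m (x^{m'} ∘ u_s)`. [folklore] -/
theorem uAct_eq_sum (s : Fin n → Fin n → ℂ) (c : degLEMonomials n → ℂ) (m : degLEMonomials n) :
    uAct s c m = ∑ m' : degLEMonomials n,
      coeff (m : Fin n →₀ ℕ) (aeval (unip s) (monomial (m' : Fin n →₀ ℕ) (1 : ℂ))) * c m' := by
  rw [uAct_apply]
  unfold ofCoeffs
  rw [map_sum, coeff_sum]
  refine Finset.sum_congr rfl fun m' _ => ?_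
  rw [show monomial (m' : Fin n →₀ ℕ) (c m') = C (c m') * monomial (m' : Fin n →₀ ℕ) (1 : ℂ) by
    rw [C_mul_monomial, mul_one], map_mul, aeval_C, algebraMap_eq, coeff_C_mul, mul_comm]

/-- **`U`-invariance, two phrasings**: a polynomial `P` in the coefficient variables with
`P(T_t c) = P(c)` for all `t, c` satisfies `P(coeff(f ∘ u_t)) = P(coeff f)` for every `f` of degree
`≤ n`. [folklore] -/
theorem eval_coeffVector_aeval_unip_of_uAct {P : MvPolynomial (degLEMonomials n) ℂ}
    (hP : ∀ (t : Fin n → Fin n → ℂ) (c : degLEMonomials n → ℂ), eval (uAct t c) P = eval c P)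
    (t : Fin n → Fin n → ℂ) (f : MvPolynomial (Fin n) ℂ) (hf : f.totalDegree ≤ n) :
    eval (coeffVector (degLEMonomials n) (aeval (unip t) f)) P =
      eval (coeffVector (degLEMonomials n) f) P := by
  rw [← uAct_coeffVector t f hf, hP]

end coeffs

end Summit.ValiantsHypothesis.ValiantsHypothesis.Theorems.BarrierLever.IsobaricEquations

end
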